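import Literature.Probability.RandomPlanarGeometry.SAWKestenHairpin
import Literature.Probability.RandomPlanarGeometry.SAWHairpinPatternTheorem
import Literature.Probability.RandomPlanarGeometry.SAWLowerBound25
import HarnessLib

/-!
# Kesten's inequality and ratio limit theorem on `ℤ²` with SHARP explicit constants

Topic `Literature/Probability/RandomPlanarGeometry` (lane pcv-sawmu, seat a-idea-1, route R40 «RATIO-SHARP»; continues
`SAWHairpinPatternTheorem.lean` (the explicit pattern theorem for tight U-turns, R39) and the tree's
`SAWKestenHairpin.lean` / `SAWKestenRatioRateZ2.lean` / `SAWKestenRatioRateZ2Std.lean`).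

PRINTED: Kesten 1963 proves `c_{N+2}/c_N → μ²` with rate `O(N^{-1/3})` and an INEXPLICIT constant; Madras–Slade 1993
(2013 reprint), Lemma 7.3.1 eq. (7.3.3) p. 242 [held scan p0255, lines 42–67] and §7.5 eq. (7.5.1) p. 255 [p0268, lines
15–25: "|c_{N+2}/c_N − μ²| ≤ K N^{-1/3} … where K is a constant"] carry the constant `D` of Theorem 7.3.2 (7.3.4),
which depends on the ineffective pattern-theorem constant. IN THE TREE: the chain is explicit (`kestenB d Q C`,
`kestenIneqZ2_of_hairpinSparse`, `ratioRate_of_hairpinSparse`) but fed with the Hammersley–Welsh/Lemma-7.2.5 hairpin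
sparsity `(Q, C) = (320, Σ_{r<20} c_r)` (`2.604 ≤ μ` edition) resp. `(1360, Σ_{r<40} c_r)` (standard axioms), so that
`B ≥ 49152 · C · Q³ ≥ 5 · 10¹⁹` resp. `≥ 4 · 10²⁹` and the rate constant `K = μ √(12(B+16))` exceeds `6 · 10¹⁰` resp. `5 · 10¹⁵`.

THIS FILE feeds the same chain with the sharp hairpin sparsity of `SAWHairpinPatternTheorem.lean`
(`Hairpin.patternTheorem_saws` / `patternTheorem_std_saws`, a tilted two-letter transfer-matrix certificate):

* `Hairpin.hairpin_density_sharp` / `hairpin_density_sharp_25` — Kesten's shape `#{#U-turns ≤ N/(4Q)} ≤ C 2^{-⌊N/Q⌋} μ^N`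
  with `(Q, C) = (42, 2.35)` (`2.604 ≤ μ`) resp. `(63, 2.43)` (standard axioms);
* `KestenHairpin.kestenIneqZ2_sharp` / `kestenIneqZ2_sharp_25` — Kesten's (7.3.3) with `B = kestenB 0 42 2.35 ≤ 3.14 · 10¹¹`
  resp. `B = kestenB 0 63 2.43 ≤ 1.06 · 10¹²` (`kestenB_sharp_le`, `kestenB_sharp_25_le`);
* `KestenHairpin.ratioRate_Z2_sharp` / `ratioRate_Z2_sharp_25` — `|c_{N+2}/c_N − μ²| ≤ μ √(12 (B + 16) (G(2N)+1)/N)`, and the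
  numeric standard-axiom form **`ratioRate_Z2_sharp_25_numeric`: `|c_{N+2}/c_N − μ²| ≤ 1.07 · 10⁷ · √((G(2N)+1)/N)` for all
  `N ≥ 1`** (`G = KestenRate.hwEnvelope μ`, `G(n) = log(n+1) + π√(2(n+1)/3) + log μ`).

No new mathematics beyond the two inputs; the point is the constant: eight (resp. nine) orders of magnitude.

## References

* H. Kesten, *On the number of self-avoiding walks*, J. Math. Phys. 4 (1963) 960–969 (ratio limit theorem).
* N. Madras, G. Slade, *The Self-Avoiding Walk*, Birkhäuser 1993 (2013 reprint): Theorem 7.2.3 p. 233; Lemma 7.3.1,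
  eq. (7.3.3) p. 242; Theorem 7.3.2, eq. (7.3.4) p. 244; §7.5, eq. (7.5.1) p. 255.
-/

open Finset
open scoped BigOperators
open Literature.Probability.LatticeModels

namespace Literature.Probability.RandomPlanarGeometry.SAW

namespace Hairpin

/-! ### From the explicit pattern theorem to Kesten's hairpin-sparsity shape `C · 2^{-⌊N/Q⌋} · μ^N` -/

/-- `2.4723^M ≤ 2^{-⌊M/63⌋} (5/2)^M` (since `(2.4723/2.5)^{63} ≤ 1/2`). [folklore] -/
private theorem pow_le_half_pow_25 (M : ℕ) : (2.4723 : ℝ) ^ M ≤ (1 / 2 : ℝ) ^ (M / 63) * (5 / 2 : ℝ) ^ M := by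
  have key : (2.4723 : ℝ) ^ 63 ≤ 1 / 2 * (5 / 2 : ℝ) ^ 63 := by norm_num
  have hM : 63 * (M / 63) + M % 63 = M := Nat.div_add_mod M 63
  calc (2.4723 : ℝ) ^ M = ((2.4723 : ℝ) ^ 63) ^ (M / 63) * (2.4723 : ℝ) ^ (M % 63) := by
        rw [← pow_mul, ← pow_add, hM]
    _ ≤ (1 / 2 * (5 / 2 : ℝ) ^ 63) ^ (M / 63) * (5 / 2 : ℝ) ^ (M % 63) := by
        gcongr
        norm_num
    _ = (1 / 2 : ℝ) ^ (M / 63) * (5 / 2 : ℝ) ^ M := by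
        rw [mul_pow, ← pow_mul, mul_assoc, ← pow_add, hM]

/-- `2.5609^M ≤ 2^{-⌊M/42⌋} 2.604^M` (since `(2.5609/2.604)^{42} ≤ 1/2`). [folklore] -/
private theorem pow_le_half_pow_2604 (M : ℕ) : (2.5609 : ℝ) ^ M ≤ (1 / 2 : ℝ) ^ (M / 42) * (2.604 : ℝ) ^ M := by
  have key : (2.5609 : ℝ) ^ 42 ≤ 1 / 2 * (2.604 : ℝ) ^ 42 := by norm_num
  have hM : 42 * (M / 42) + M % 42 = M := Nat.div_add_mod M 42
  calc (2.5609 : ℝ) ^ M = ((2.5609 : ℝ) ^ 42) ^ (M / 42) * (2.5609 : ℝ) ^ (M % 42) := by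
        rw [← pow_mul, ← pow_add, hM]
    _ ≤ (1 / 2 * (2.604 : ℝ) ^ 42) ^ (M / 42) * (2.604 : ℝ) ^ (M % 42) := by
        gcongr
        norm_num
    _ = (1 / 2 : ℝ) ^ (M / 42) * (2.604 : ℝ) ^ M := by
        rw [mul_pow, ← pow_mul, mul_assoc, ← pow_add, hM]

open Classical in
/-- Monotonicity of the sparse-hairpin event in the threshold. [folklore] -/
private theorem card_filter_occ_mono (n : ℕ) {k k' : ℕ} (hk : k ≤ k') :
    ((Zd.saws 2 n).filter fun ω => Zd.occ Zd.hairpinAt n ω ≤ k).card ≤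
      ((Zd.saws 2 n).filter fun ω => Zd.occ Zd.hairpinAt n ω ≤ k').card :=
  Finset.card_le_card fun ω hω => by
    rw [Finset.mem_filter] at hω ⊢
    exact ⟨hω.1, hω.2.trans hk⟩

open Classical in
/-- The length-`0` case: only the trivial walk. [folklore] -/
private theorem card_filter_occ_zero_le (k : ℕ) :
    (((Zd.saws 2 0).filter fun ω => Zd.occ Zd.hairpinAt 0 ω ≤ k).card : ℝ) ≤ 1 := by
  have h : ((Zd.saws 2 0).filter fun ω => Zd.occ Zd.hairpinAt 0 ω ≤ k).card ≤ 1 := by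
    calc _ ≤ (Zd.saws 2 0).card := Finset.card_filter_le _ _
      _ = 1 := by rw [Zd.card_saws, Zd.count_zero]
  exact_mod_cast h

open Classical in
/-- **Hairpin sparsity on `ℤ²` in Kesten's shape, standard axioms, SHARP constants**: for every `N`,
`#{ω ∈ S_N : #U-turns ≤ N/252} ≤ 2.43 · 2^{-⌊N/63⌋} · μ^N` (from `patternTheorem_std_saws`: `a = 1/200 ≥ 1/252`,
`6 · 2.4723^{N-1} ≤ 2.43 · 2.4723^N ≤ 2.43 · 2^{-⌊N/63⌋} (5/2)^N`, `5/2 ≤ μ`). The tree's standard-axiom twin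
`Zd.hairpin_density_explicit_25` has `(Q, C) = (1360, Σ_{r<40} c_r)`; here `(Q, C) = (63, 2.43)`.
[cite: MadrasSlade1993, Theorem 7.2.3 (instance: the U-turn pattern on ℤ², explicit sharp constants)] -/
theorem hairpin_density_sharp_25 (N : ℕ) :
    (((Zd.saws 2 N).filter fun ω => Zd.occ Zd.hairpinAt N ω ≤ N / (4 * 63)).card : ℝ) ≤
      2.43 * (1 / 2 : ℝ) ^ (N / 63) * Zd.connectiveConstant 2 ^ N := by
  cases N with
  | zero => exact (card_filter_occ_zero_le _).trans (by norm_num)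
  | succ N =>
    have hmono := card_filter_occ_mono (N + 1) (k := (N + 1) / (4 * 63)) (k' := (N + 1) / 200)
      (Nat.div_le_div_left (by norm_num) (by norm_num))
    have h1 := (patternTheorem_std_saws N).1
    have h2 := pow_le_half_pow_25 (N + 1)
    have h3 : (5 / 2 : ℝ) ^ (N + 1) ≤ Zd.connectiveConstant 2 ^ (N + 1) :=
      pow_le_pow_left₀ (by norm_num) Zd.le_connectiveConstant_two_25 (N + 1)
    have h4 : (0 : ℝ) ≤ (1 / 2 : ℝ) ^ ((N + 1) / 63) := by positivity
    calc (((Zd.saws 2 (N + 1)).filter fun ω => Zd.occ Zd.hairpinAt (N + 1) ω ≤ (N + 1) / (4 * 63)).card : ℝ)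
        ≤ (((Zd.saws 2 (N + 1)).filter fun ω => Zd.occ Zd.hairpinAt (N + 1) ω ≤ (N + 1) / 200).card : ℝ) := by
          exact_mod_cast hmono
      _ ≤ 6 * (2.4723 : ℝ) ^ N := h1
      _ ≤ 2.43 * (2.4723 : ℝ) ^ (N + 1) := by
          rw [pow_succ]; nlinarith [pow_nonneg (show (0 : ℝ) ≤ 2.4723 by norm_num) N]
      _ ≤ 2.43 * ((1 / 2 : ℝ) ^ ((N + 1) / 63) * (5 / 2 : ℝ) ^ (N + 1)) := by
          exact mul_le_mul_of_nonneg_left h2 (by norm_num)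
      _ ≤ 2.43 * ((1 / 2 : ℝ) ^ ((N + 1) / 63) * Zd.connectiveConstant 2 ^ (N + 1)) := by
          exact mul_le_mul_of_nonneg_left (mul_le_mul_of_nonneg_left h3 h4) (by norm_num)
      _ = 2.43 * (1 / 2 : ℝ) ^ ((N + 1) / 63) * Zd.connectiveConstant 2 ^ (N + 1) := by ring

open Classical in
/-- **Hairpin sparsity on `ℤ²` in Kesten's shape, SHARP constants, `2.604 ≤ μ` edition**: for every `N`,
`#{ω ∈ S_N : #U-turns ≤ N/168} ≤ 2.35 · 2^{-⌊N/42⌋} · μ^N` (from `patternTheorem_saws`: `a = 1/60 ≥ 1/168`,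
`6 · 2.5609^{N-1} ≤ 2.35 · 2.5609^N ≤ 2.35 · 2^{-⌊N/42⌋} 2.604^N`, `2.604 ≤ μ`). The tree's twin
`Zd.hairpin_density_explicit` has `(Q, C) = (320, Σ_{r<20} c_r)`; here `(Q, C) = (42, 2.35)`.
[cite: MadrasSlade1993, Theorem 7.2.3 (instance: the U-turn pattern on ℤ², explicit sharp constants)] -/
theorem hairpin_density_sharp (N : ℕ) :
    (((Zd.saws 2 N).filter fun ω => Zd.occ Zd.hairpinAt N ω ≤ N / (4 * 42)).card : ℝ) ≤
      2.35 * (1 / 2 : ℝ) ^ (N / 42) * Zd.connectiveConstant 2 ^ N := by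
  cases N with
  | zero => exact (card_filter_occ_zero_le _).trans (by norm_num)
  | succ N =>
    have hmono := card_filter_occ_mono (N + 1) (k := (N + 1) / (4 * 42)) (k' := (N + 1) / 60)
      (Nat.div_le_div_left (by norm_num) (by norm_num))
    have h1 := (patternTheorem_saws N).1
    have h2 := pow_le_half_pow_2604 (N + 1)
    have h3 : (2.604 : ℝ) ^ (N + 1) ≤ Zd.connectiveConstant 2 ^ (N + 1) := by
      apply pow_le_pow_left₀ (by norm_num)
      rw [Zd.connectiveConstant_two]; exact le_connectiveConstant_2604
    have h4 : (0 : ℝ) ≤ (1 / 2 : ℝ) ^ ((N + 1) / 42) := by positivity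
    calc (((Zd.saws 2 (N + 1)).filter fun ω => Zd.occ Zd.hairpinAt (N + 1) ω ≤ (N + 1) / (4 * 42)).card : ℝ)
        ≤ (((Zd.saws 2 (N + 1)).filter fun ω => Zd.occ Zd.hairpinAt (N + 1) ω ≤ (N + 1) / 60).card : ℝ) := by
          exact_mod_cast hmono
      _ ≤ 6 * (2.5609 : ℝ) ^ N := h1
      _ ≤ 2.35 * (2.5609 : ℝ) ^ (N + 1) := by
          rw [pow_succ]; nlinarith [pow_nonneg (show (0 : ℝ) ≤ 2.5609 by norm_num) N]
      _ ≤ 2.35 * ((1 / 2 : ℝ) ^ ((N + 1) / 42) * (2.604 : ℝ) ^ (N + 1)) := by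
          exact mul_le_mul_of_nonneg_left h2 (by norm_num)
      _ ≤ 2.35 * ((1 / 2 : ℝ) ^ ((N + 1) / 42) * Zd.connectiveConstant 2 ^ (N + 1)) := by
          exact mul_le_mul_of_nonneg_left (mul_le_mul_of_nonneg_left h3 h4) (by norm_num)
      _ = 2.35 * (1 / 2 : ℝ) ^ ((N + 1) / 42) * Zd.connectiveConstant 2 ^ (N + 1) := by ring

end Hairpin

/-! ### Kesten's inequality and the explicit ratio rate on `ℤ²` with SHARP constants -/

namespace Zd.KestenHairpin

/-- **The hairpin-sparsity input on `ℤ²`, standard axioms, sharp**: `(Q, C) = (63, 2.43)`.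
[cite: MadrasSlade1993, Theorem 7.2.3 (U-turn instance, explicit sharp constants)] -/
theorem hairpinSparse_Z2_sharp_25 : HairpinSparse 0 63 2.43 := by
  intro N
  have h := Hairpin.hairpin_density_sharp_25 N
  exact h

/-- **The hairpin-sparsity input on `ℤ²`, `2.604 ≤ μ` edition, sharp**: `(Q, C) = (42, 2.35)`.
[cite: MadrasSlade1993, Theorem 7.2.3 (U-turn instance, explicit sharp constants)] -/
theorem hairpinSparse_Z2_sharp : HairpinSparse 0 42 2.35 := by
  intro N
  have h := Hairpin.hairpin_density_sharp N
  exact h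

/-- **Kesten's inequality (7.3.3) on `ℤ²`, standard axioms, sharp constant**: `c_{n+2}/c_n − B/n ≤ c_{n+4}/c_{n+2}`
for all `n ≥ 1` with `B = kestenB 0 63 2.43 ≤ 1.06 · 10¹²` (the tree's standard-axiom constant is
`kestenB 0 1360 (Σ_{r<40} c_r) ≥ 49152 · (5/2)^{39} · 1360³ ≥ 4 · 10²⁹`).
[cite: MadrasSlade1993, Lemma 7.3.1, eq. (7.3.3) and Theorem 7.3.2 (a) (explicit sharp constant)] -/
theorem kestenIneqZ2_sharp_25 : KestenIneqZ2 (kestenB 0 63 2.43) :=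
  kestenIneqZ2_of_hairpinSparse (by norm_num) hairpinSparse_Z2_sharp_25

/-- **Kesten's inequality (7.3.3) on `ℤ²`, `2.604 ≤ μ` edition, sharp constant**: `B = kestenB 0 42 2.35 ≤ 3.14 · 10¹¹`
(the tree's `kestenIneqZ2_holds` has `kestenB 0 320 (Σ_{r<20} c_r) ≥ 49152 · (5/2)^{19} · 320³ ≥ 5 · 10¹⁹`).
[cite: MadrasSlade1993, Lemma 7.3.1, eq. (7.3.3) and Theorem 7.3.2 (a) (explicit sharp constant)] -/
theorem kestenIneqZ2_sharp : KestenIneqZ2 (kestenB 0 42 2.35) :=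
  kestenIneqZ2_of_hairpinSparse (by norm_num) hairpinSparse_Z2_sharp

/-- `kestenB 0 63 2.43 ≤ 1.06 · 10¹²` (the explicit constant of Kesten's inequality (7.3.3), standard-axiom edition). [cite: MadrasSlade1993, Lemma 7.3.1, eq. (7.3.3) (explicit constant, numeric bound)] -/
theorem kestenB_sharp_25_le : kestenB 0 63 2.43 ≤ 1.06e12 := by
  unfold kestenB; norm_num

/-- `kestenB 0 42 2.35 ≤ 3.14 · 10¹¹` (the explicit constant of Kesten's inequality (7.3.3), `2.604 ≤ μ` edition). [cite: MadrasSlade1993, Lemma 7.3.1, eq. (7.3.3) (explicit constant, numeric bound)] -/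
theorem kestenB_sharp_le : kestenB 0 42 2.35 ≤ 3.14e11 := by
  unfold kestenB; norm_num

/-- **Kesten's ratio limit theorem on `ℤ²` with an explicit rate, standard axioms, sharp constant**: for every
`N ≥ 1`, `|c_{N+2}/c_N − μ²| ≤ μ √(12 (B + 16) (G(2N) + 1)/N)` with `B = kestenB 0 63 2.43 ≤ 1.06 · 10¹²` and
`G = KestenRate.hwEnvelope μ`. [cite: MadrasSlade1993, §7.5, eq. (7.5.1) and Theorem 7.3.2 (a) (quantitative form,
unconditional on ℤ², sharp constant)] -/
theorem ratioRate_Z2_sharp_25 {N : ℕ} (hN : 1 ≤ N) :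
    |(count 2 (N + 2) : ℝ) / count 2 N - connectiveConstant 2 ^ 2| ≤
      connectiveConstant 2 *
        Real.sqrt (12 * (kestenB 0 63 2.43 + 16) *
          (KestenRate.hwEnvelope (connectiveConstant 2) (2 * N) + 1) / N) := by
  have h := ratioRate_of_hairpinSparse (d := 0) (by norm_num) hairpinSparse_Z2_sharp_25 hN
  have e2 : (2 * (((0 : ℕ) : ℝ) + 2)) ^ 2 = 16 := by norm_num
  rw [e2] at h
  exact h

/-- **Kesten's ratio limit theorem on `ℤ²` with an explicit rate, `2.604 ≤ μ` edition, sharp constant**: for every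
`N ≥ 1`, `|c_{N+2}/c_N − μ²| ≤ μ √(12 (B + 16) (G(2N) + 1)/N)` with `B = kestenB 0 42 2.35 ≤ 3.14 · 10¹¹`.
[cite: MadrasSlade1993, §7.5, eq. (7.5.1) and Theorem 7.3.2 (a) (quantitative form, unconditional on ℤ², sharp
constant)] -/
theorem ratioRate_Z2_sharp {N : ℕ} (hN : 1 ≤ N) :
    |(count 2 (N + 2) : ℝ) / count 2 N - connectiveConstant 2 ^ 2| ≤
      connectiveConstant 2 *
        Real.sqrt (12 * (kestenB 0 42 2.35 + 16) *
          (KestenRate.hwEnvelope (connectiveConstant 2) (2 * N) + 1) / N) := by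
  have h := ratioRate_of_hairpinSparse (d := 0) (by norm_num) hairpinSparse_Z2_sharp hN
  have e2 : (2 * (((0 : ℕ) : ℝ) + 2)) ^ 2 = 16 := by norm_num
  rw [e2] at h
  exact h

/-- **The numeric rate constant, standard axioms**: for every `N ≥ 1`,
`|c_{N+2}/c_N − μ²| ≤ 1.07 · 10⁷ · √((G(2N) + 1)/N)` (`μ ≤ 3`, `B ≤ 1.06 · 10¹²`; the tree's standard-axiom
constant `μ √(12 (B_tree + 16))` exceeds `5 · 10¹⁵`). [cite: MadrasSlade1993, §7.5, eq. (7.5.1) (quantitative form,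
unconditional on ℤ², numeric constant)] -/
theorem ratioRate_Z2_sharp_25_numeric {N : ℕ} (hN : 1 ≤ N) :
    |(count 2 (N + 2) : ℝ) / count 2 N - connectiveConstant 2 ^ 2| ≤
      1.07e7 * Real.sqrt ((KestenRate.hwEnvelope (connectiveConstant 2) (2 * N) + 1) / N) := by
  have h := ratioRate_Z2_sharp_25 hN
  have hμ0 : 0 < connectiveConstant 2 := connectiveConstant_pos 2
  have hμ3 : connectiveConstant 2 ≤ 3 := by
    have := connectiveConstant_le 2 (by norm_num); norm_num at this; exact this
  have hB := kestenB_sharp_25_le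
  have hB0 : 0 ≤ kestenB 0 63 2.43 := by unfold kestenB; positivity
  set B := kestenB 0 63 2.43
  set G := KestenRate.hwEnvelope (connectiveConstant 2) (2 * N)
  have hG1 : 0 ≤ (G + 1) / N := by
    have hG : 0 ≤ G := by
      simp only [G, KestenRate.hwEnvelope]
      have h1 : 0 ≤ Real.log ((((2 * N : ℕ) : ℝ)) + 1) := Real.log_nonneg (by norm_cast; omega)
      have h2 : 0 ≤ Real.log (connectiveConstant 2) := Real.log_nonneg (by linarith [le_connectiveConstant_two_25])
      positivity
    positivity
  have hsplit : Real.sqrt (12 * (B + 16) * (G + 1) / N) = Real.sqrt (12 * (B + 16)) * Real.sqrt ((G + 1) / N) := by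
    rw [← Real.sqrt_mul (by positivity)]; congr 1; ring
  rw [hsplit, ← mul_assoc] at h
  refine h.trans (mul_le_mul_of_nonneg_right ?_ (Real.sqrt_nonneg _))
  have hs : Real.sqrt (12 * (B + 16)) ≤ 3566654 := by
    rw [Real.sqrt_le_left (by norm_num)]
    nlinarith [hB]
  calc connectiveConstant 2 * Real.sqrt (12 * (B + 16)) ≤ 3 * 3566654 :=
        mul_le_mul hμ3 hs (Real.sqrt_nonneg _) (by norm_num)
    _ ≤ 1.07e7 := by norm_num

end Zd.KestenHairpin

end Literature.Probability.RandomPlanarGeometry.SAW
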